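import Literature.NumberTheory.Automorphic.HLTTCompatible
import Literature.NumberTheory.GaloisRepresentations.FramedRepEquivConj
import Literature.NumberTheory.GaloisRepresentations.GaloisRepFrobeniusProofs
import HarnessLib

/-!
# Automorphy of an `ℓ`-adic Galois representation of a number field (almost-everywhere form)

Topic `Literature/NumberTheory/Automorphic`.  Let `K` be a number field, `ℓ` a prime,
`ι : ℚ̄_ℓ ≃+* ℂ` (`ℚ̄_ℓ = PadicAlgCl ℓ`), `ρ : Γ_K →ₜ* GL_n(ℚ̄_ℓ)` a framed continuous Galois
representation (accepted `FramedGaloisRep`, with `IsUnramifiedAt`, `HasFrobCharpolyAt` — the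
characteristic polynomial of the *arithmetic* Frobenius) and `π = W / W'` an automorphic
representation of `GL_n(𝔸_K)` (accepted `AutomorphicRepData (AutomorphyDatum.gl n K hcpt)` with
its adelic Satake parameters `HasSatakeParamAt` and Buzzard–Gee's `IsLAlgebraic`; cuspidal ones are
`CuspidalAutomorphicRepData n K hcpt`, where the named fact `hcpt : isCompact_glFiniteIntegralLevel n K`
only *types* `π`, D-0014).  This file names two predicates that so far occurred only inline:

* `SatakeFrobCompatibleAE ι π ρ` — **`ρ` is attached to `π` (via `ι`) at almost all places**: for
  all but finitely many finite places `v`, `π` is unramified at `v` with Satake parameter `α`,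
  `ρ` is unramified at `v`, and every arithmetic Frobenius at `v` has characteristic polynomial
  `∏_j (X - ι⁻¹(α_j⁻¹)) = arithFrobPolyOfSatake ι q_v 1 α` (Buzzard–Gee's L-normalisation, no
  half-twist; their dictionary "geometric Frobenius ↔ uniformiser", Rem. 3.2.5, so the geometric
  Frobenius has the eigenvalues `ι⁻¹(α_j)` of `r_{π_v}`).  This is the second bullet of
  Buzzard–Gee's Conj. 3.2.1 for `G = GL_n` with the finite exceptional set `S` bound by
  `∀ᶠ v in cofinite`, i.e. Taylor's "two objects `M` and `M'` should correspond if the local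
  `L`-factors `L_p(M,X)` and `L_p(M',X)` are equal for all but finitely many `p`" (Taylor, *Galois
  representations*, Ann. Fac. Sci. Toulouse 13 (2004), §1, arXiv:math/0212403 p. 10).
* `IsAutomorphicAE ι hcpt ρ` — **`ρ` is automorphic**: some L-algebraic *cuspidal* `π` of
  `GL_n(𝔸_K)` is attached to `ρ` at almost all places.  This is VERBATIM the conclusion of the
  accepted named fact `FontaineMazurLanglandsGLn` (lang.S03, Fontaine–Mazur 1995 Conj. 1 with
  Langlands; Buzzard–Gee 2014 Conj. 3.2.2), see `fontaineMazurLanglandsGLn_iff` (`Iff.rfl`), and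
  the automorphy clause repeated inline in the sector routes for direction (B) "Galois →
  automorphic" of the summit `Langlands` (e.g. route PhantomRM: `PhantomRMSector`,
  `ResiduallyYoshidaLifting`'s `Aut`, `StableYoshidaCongruence`), see `isAutomorphicAE_iff`
  (`Iff.rfl`).

## API

* `satakeFrobCompatibleAE_conj_iff`, `isAutomorphicAE_conj_iff`: invariance under a change of
  frame `ρ ↦ P ρ P⁻¹` (`FramedRep.conj`; from the accepted `FramedGaloisRep.isUnramifiedAt_conj_iff`
  and `HLTT.hasFrobCharpolyAt_conj_iff` of the facts-free `HLTTCompatible`);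
* `SatakeFrobCompatibleAE.of_equiv`, `IsAutomorphicAE.of_equiv`: invariance under isomorphism of
  the underlying continuous representations on `ℚ̄_ℓⁿ` (`FramedRep.exists_eq_conj_of_equiv`);
* `SatakeFrobCompatibleAE.eventually_isUnramifiedAt`, `IsAutomorphicAE.eventually_isUnramifiedAt`:
  both partners are unramified almost everywhere;
* `SatakeFrobCompatibleAE.isNearlyEquivalent`: **uniqueness of `π` up to near-equivalence** — two
  automorphic representations attached to the same `ρ` have the same Satake parameters at almost
  all places (accepted `AutomorphicRepData.IsNearlyEquivalent`), because the characteristic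
  polynomial of Frobenius at a place is unique (`GaloisRep.HasFrobCharpolyAt.unique_holds`) and
  `α ↦ ∏_j (X - ι⁻¹(α_j⁻¹))` is injective (`arithFrobPolyOfSatake_one_injective`); for cuspidal
  `π, π'` strong multiplicity one (Jacquet–Shalika 1981, Thm. 4.8; the tree's named fact
  `strong_multiplicity_one_gl`, stated in the `L²` language) upgrades this to `π ≅ π'` — not
  restated here;
* `IsAutomorphicAE.exists_of_imp`: the **bridge to the summit's `Corresponds`**.  `Literature/`
  never imports `Summits/`, so the local–global compatibility clause is a parameter
  `C : CuspidalAutomorphicRepData n K hcpt → Prop`: from `IsAutomorphicAE ι hcpt ρ` and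
  `∀ π, π.1.IsLAlgebraic → SatakeFrobCompatibleAE ι π.1 ρ → C π` one gets
  `∃ π, π.1.IsLAlgebraic ∧ SatakeFrobCompatibleAE ι π.1 ρ ∧ C π`; with
  `C π := ∀ v, Summit.Langlands.LocalGlobalCompatibleAt 𝓡 ι π.1 ρ v` the conclusion is
  definitionally `∃ π, π.1.IsLAlgebraic ∧ Summit.Langlands.Corresponds 𝓡 ι π.1 ρ`
  (`Corresponds 𝓡 ι π ρ = (∀ᶠ v in cofinite, SatakeFrobCompatibleAt ι π ρ v) ∧ ∀ v, …` and
  `SatakeFrobCompatibleAE ι π ρ` unfolds to `∀ᶠ v in cofinite, <body of SatakeFrobCompatibleAt ι π ρ v>`).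
  Conversely the conclusion `∃ π, π.1.IsLAlgebraic ∧ Corresponds 𝓡 ι π.1 ρ` of the summit's
  direction (B) gives `IsAutomorphicAE ι hcpt ρ` as `⟨π, h.1, h.2.1⟩`.

## Design notes / what is NOT here

* The per-place predicate is the summit's `Summit.Langlands.SatakeFrobCompatibleAt ι π ρ v`
  (problem side); it is not restated: `SatakeFrobCompatibleAE` inlines its body under
  `∀ᶠ v in cofinite`, so that the two agree definitionally.
* No local–global compatibility at the ramified places or at `v ∣ ℓ`, no Hodge–Tate weights, no
  condition at the real places (Buzzard–Gee Conj. 3.2.1, bullets 3–4): as in the accepted lang.S03,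
  only the unramified compatibility almost everywhere, which determines `ρ` up to
  semisimplification (Chebotarev + Brauer–Nesbitt) and `π` up to near-equivalence
  (`SatakeFrobCompatibleAE.isNearlyEquivalent`).
* `hcpt` is a proof of a `Prop`, so `IsAutomorphicAE ι hcpt ρ` does not depend on its choice
  (proof irrelevance); it is explicit because it types the witness `π`, as in the summit's
  `Summit.Langlands.GaloisToAutomorphic 𝓡 hcpt`.  `K : Type` (universe `0`) is forced by
  `CuspidalAutomorphicRepData`.
* Mathlib has no automorphic Galois representations (`lean search 'IsAutomorphic'`: only the
  unrelated `Γ`-invariance predicate `IsAutomorphic Γ f` for functions on `ℍ` in this tree's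
  `IncompleteEisensteinSeries`, different arity and namespace).

## References

* K. Buzzard, T. Gee, *The conjectural connections between automorphic representations and Galois
  representations*, LMS Lecture Note Ser. 414 (2014), Conj. 3.2.1, Conj. 3.2.2, Rem. 3.2.5
  (arXiv:1009.0785, p. 14). [BuzzardGeeLMS2014]
* J.-M. Fontaine, B. Mazur, *Geometric Galois representations* (1995), Conj. 1.
  [FontaineMazurGeometric1995]
* R. Taylor, *Galois representations*, Ann. Fac. Sci. Toulouse Math. (6) 13 (2004), 73–119, §1
  and Conj. 7–8 of the ICM text (arXiv:math/0212403, pp. 9–10). [TaylorGaloisRepresentations2004]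
* H. Jacquet, J. Shalika, *On Euler products and the classification of automorphic forms II*,
  Amer. J. Math. 103 (1981), Thm. 4.8 (strong multiplicity one). [JacquetShalika1981]
* J.-P. Serre, *Abelian ℓ-adic representations and elliptic curves* (1968), Ch. I §2.3
  (`P_{v,ρ}` is an invariant of the isomorphism class). [SerreAbelianLadic1968]
-/

open scoped MatrixGroups Matrix Classical Polynomial NumberField
open NumberField IsDedekindDomain Field Polynomial Filter
open Literature.NumberTheory.GaloisRepresentations

noncomputable section

namespace Literature.NumberTheory.Automorphic

/-! ## Injectivity of the Satake-to-Frobenius dictionary -/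

section FrobPoly

variable {ℓ : ℕ} [Fact ℓ.Prime]

/-- The L-normalised dictionary `α ↦ ∏_{a ∈ α} (X - ι⁻¹(a⁻¹)) = arithFrobPolyOfSatake ι q 1 α`
is injective on multisets: the roots of the right-hand side are the `ι⁻¹(a⁻¹)`
(`roots_arithFrobPolyOfSatake`), and `a ↦ ι⁻¹(a⁻¹)` is injective on `ℂ` (Mathlib
`Multiset.map_injective`, `inv_inj`).  Hence the Satake parameter of `π_v` is determined by the
characteristic polynomial of Frobenius of an attached Galois representation.
Buzzard–Gee 2014, §2.1 and Rem. 3.2.5. [folklore] -/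
theorem arithFrobPolyOfSatake_one_injective (ι : PadicAlgCl ℓ ≃+* ℂ) (q : ℕ) :
    Function.Injective (arithFrobPolyOfSatake ι q 1) := by
  intro α β h
  have hr := congrArg Polynomial.roots h
  rw [roots_arithFrobPolyOfSatake, roots_arithFrobPolyOfSatake] at hr
  exact Multiset.map_injective (fun a b hab ↦ by simpa using hab) hr

end FrobPoly

/-! ## `ρ` is attached to `π` at almost all places -/

section Compatible

variable {n : ℕ} {K : Type} [Field K] [NumberField K] {hcpt : isCompact_glFiniteIntegralLevel n K}
  {ℓ : ℕ} [Fact ℓ.Prime]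

/-- **`ρ` is attached to `π` via `ι` at almost all places** (`ρ ≃ ρ_{π,ι}` almost everywhere):
for all but finitely many finite places `v` of `K` (`∀ᶠ v in cofinite`: the finite exceptional set
`S` of Buzzard–Gee's Conj. 3.2.1 is bound here), `π` is unramified at `v` with Satake parameter
`α` (accepted `HasSatakeParamAt`, unitary normalisation `α_j = χ_j(ϖ_v)`), `ρ` is unramified at
`v`, and every arithmetic Frobenius at `v` has characteristic polynomial
`∏_j (X - ι⁻¹(α_j⁻¹)) = arithFrobPolyOfSatake ι q_v 1 α` (L-normalisation, no half-twist;
equivalently the geometric Frobenius has the eigenvalues `ι⁻¹(α_j)` of `r_{π_v}(Frob_v)` under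
Buzzard–Gee's dictionary geometric Frobenius ↔ uniformiser, Rem. 3.2.5) — the second bullet of
Buzzard–Gee's Conj. 3.2.1 ("if `v ∉ S`, then `ρ_π|_{W_{F_v}}` is `Ĝ(ℚ̄_p)`-conjugate to
`ι(r_{π_v})`") for `G = GL_n`.  Same clause, place by place, as the summit's
`Summit.Langlands.SatakeFrobCompatibleAt` and as the accepted lang.S03
`FontaineMazurLanglandsGLn`. [cite: BuzzardGeeLMS2014, Conj. 3.2.1 and Rem. 3.2.5] -/
def SatakeFrobCompatibleAE (ι : PadicAlgCl ℓ ≃+* ℂ)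
    (π : AutomorphicRepData (AutomorphyDatum.gl n K hcpt)) (ρ : FramedGaloisRep K (PadicAlgCl ℓ) n) :
    Prop :=
  ∀ᶠ v : HeightOneSpectrum (𝓞 K) in cofinite, ∃ α : Multiset ℂ,
    π.HasSatakeParamAt v α ∧ ρ.IsUnramifiedAt v ∧
      ρ.HasFrobCharpolyAt v (arithFrobPolyOfSatake ι v.residueCard 1 α)

variable {ι : PadicAlgCl ℓ ≃+* ℂ} {π π' : AutomorphicRepData (AutomorphyDatum.gl n K hcpt)}
  {ρ ρ' : FramedGaloisRep K (PadicAlgCl ℓ) n}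

/-- If `ρ` is attached to `π` at almost all places then both are unramified at all but finitely
many places (the clause is conjunctive). Buzzard–Gee 2014, Conj. 3.2.1. [folklore] -/
theorem SatakeFrobCompatibleAE.eventually_isUnramifiedAt (h : SatakeFrobCompatibleAE ι π ρ) :
    ∀ᶠ v : HeightOneSpectrum (𝓞 K) in cofinite, π.IsUnramifiedAt v ∧ ρ.IsUnramifiedAt v :=
  h.mono fun _ ⟨α, hα, hρ, _⟩ ↦ ⟨⟨α, hα⟩, hρ⟩

variable (ι π ρ) in
/-- Being attached to `π` at almost all places is invariant under a change of frame
`ρ ↦ P ρ P⁻¹` (`FramedRep.conj`): unramifiedness and the characteristic polynomial of Frobenius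
are (`FramedGaloisRep.isUnramifiedAt_conj_iff`, `HLTT.hasFrobCharpolyAt_conj_iff`).
Serre 1968, Ch. I §2.3. [folklore] -/
theorem satakeFrobCompatibleAE_conj_iff (P : GL (Fin n) (PadicAlgCl ℓ)) :
    SatakeFrobCompatibleAE ι π (FramedRep.conj P ρ) ↔ SatakeFrobCompatibleAE ι π ρ := by
  simp only [SatakeFrobCompatibleAE, FramedGaloisRep.isUnramifiedAt_conj_iff,
    HLTT.hasFrobCharpolyAt_conj_iff]

/-- Being attached to `π` at almost all places is an invariant of the isomorphism class of the
continuous representation on `ℚ̄_ℓⁿ` underlying `ρ` (equivalent framed representations are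
conjugate, `FramedRep.exists_eq_conj_of_equiv`). Serre 1968, Ch. I §1.1, §2.3.
[cite: SerreAbelianLadic1968, Ch. I §2.3] -/
theorem SatakeFrobCompatibleAE.of_equiv (e : ContinuousRep.Equiv ρ.toGaloisRep ρ'.toGaloisRep)
    (h : SatakeFrobCompatibleAE ι π ρ) : SatakeFrobCompatibleAE ι π ρ' := by
  obtain ⟨P, rfl⟩ := FramedRep.exists_eq_conj_of_equiv ρ ρ' e
  exact (satakeFrobCompatibleAE_conj_iff ι π ρ P).mpr h

/-- **The automorphic partner is unique up to near-equivalence.**  If `ρ` is attached at almost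
all places both to `π` and to `π'`, then `π` and `π'` are nearly equivalent (accepted
`AutomorphicRepData.IsNearlyEquivalent`: the same Satake parameter at almost all places): at a
place in the intersection of the two cofinite sets the two predicted polynomials are both *the*
characteristic polynomial of Frobenius of `ρ` (`GaloisRep.HasFrobCharpolyAt.unique_holds`, through
`FramedGaloisRep.hasFrobCharpolyAt_toGaloisRep_iff`), and the dictionary `α ↦ ∏ (X - ι⁻¹(α_j⁻¹))`
is injective (`arithFrobPolyOfSatake_one_injective`).  For cuspidal `π, π'` strong multiplicity
one (Jacquet–Shalika 1981, Thm. 4.8; named fact `strong_multiplicity_one_gl`) then gives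
`π ≅ π'`. [cite: JacquetShalika1981, §4 and Thm. 4.8] -/
theorem SatakeFrobCompatibleAE.isNearlyEquivalent (h : SatakeFrobCompatibleAE ι π ρ)
    (h' : SatakeFrobCompatibleAE ι π' ρ) : π.IsNearlyEquivalent π' := by
  filter_upwards [h, h'] with v ⟨α, hα, _, hP⟩ ⟨α', hα', _, hP'⟩
  have hPP' : arithFrobPolyOfSatake ι v.residueCard 1 α =
      arithFrobPolyOfSatake ι v.residueCard 1 α' :=
    GaloisRep.HasFrobCharpolyAt.unique_holds
      ((FramedGaloisRep.hasFrobCharpolyAt_toGaloisRep_iff v _ ρ).mpr hP)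
      ((FramedGaloisRep.hasFrobCharpolyAt_toGaloisRep_iff v _ ρ).mpr hP')
  obtain rfl := arithFrobPolyOfSatake_one_injective ι v.residueCard hPP'
  exact ⟨α, hα, hα'⟩

end Compatible

/-! ## Automorphic Galois representations -/

section Automorphic

variable {n : ℕ} {K : Type} [Field K] [NumberField K] {ℓ : ℕ} [Fact ℓ.Prime]

/-- **`ρ : Γ_K →ₜ* GL_n(ℚ̄_ℓ)` is automorphic** (almost-everywhere form, via `ι : ℚ̄_ℓ ≃+* ℂ`):
there is an **L-algebraic cuspidal** automorphic representation `π` of `GL_n(𝔸_K)` (accepted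
`CuspidalAutomorphicRepData n K hcpt`, `IsLAlgebraic` = Buzzard–Gee Def. 3.1.1) to which `ρ` is
attached at almost all places (`SatakeFrobCompatibleAE ι π.1 ρ`: at all but finitely many `v`,
`π_v` is unramified with Satake parameter `α`, `ρ` is unramified and the arithmetic Frobenius has
characteristic polynomial `∏_j (X - ι⁻¹(α_j⁻¹))`).  This is verbatim the conclusion of the
Fontaine–Mazur–Langlands conjecture for `GL_n` as accepted in the tree
(`FontaineMazurLanglandsGLn`, lang.S03; `fontaineMazurLanglandsGLn_iff`): Fontaine–Mazur 1995,
Conj. 1 combined with Langlands' reciprocity in Buzzard–Gee's form, Conj. 3.2.2 ("Assume that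
`π` is L-algebraic … there is a continuous Galois representation `ρ_{π,ι}` … if `v ∉ S`, then
`ρ_{π,ι}|_{W_{F_v}}` is `Ĝ(ℚ̄_p)`-conjugate to `ι(r_{π_v})`"), read in the Galois-to-automorphic
direction (Taylor 2004, Conj. 8).  It is the almost-everywhere form of `ρ ≅ ρ_{π,ι}`, equivalent
to it for irreducible `ρ` (Chebotarev + Brauer–Nesbitt); `π` is unique up to near-equivalence
(`SatakeFrobCompatibleAE.isNearlyEquivalent`), hence unique by strong multiplicity one.  `hcpt`
(a proof of the named fact `isCompact_glFiniteIntegralLevel n K`) only types `π`.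
[cite: BuzzardGeeLMS2014, Conj. 3.2.2] [cite: FontaineMazurGeometric1995, Conj. 1] -/
def IsAutomorphicAE (ι : PadicAlgCl ℓ ≃+* ℂ) (hcpt : isCompact_glFiniteIntegralLevel n K)
    (ρ : FramedGaloisRep K (PadicAlgCl ℓ) n) : Prop :=
  ∃ π : CuspidalAutomorphicRepData n K hcpt, π.1.IsLAlgebraic ∧ SatakeFrobCompatibleAE ι π.1 ρ

variable {ι : PadicAlgCl ℓ ≃+* ℂ} {hcpt : isCompact_glFiniteIntegralLevel n K}
  {ρ ρ' : FramedGaloisRep K (PadicAlgCl ℓ) n}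

variable (ι hcpt ρ) in
/-- Unfolding lemma: `IsAutomorphicAE ι hcpt ρ` is, definitionally, the inline automorphy clause
`∃ π, π.1.IsLAlgebraic ∧ ∀ᶠ v in cofinite, ∃ α, π.1.HasSatakeParamAt v α ∧ ρ.IsUnramifiedAt v ∧
ρ.HasFrobCharpolyAt v (arithFrobPolyOfSatake ι q_v 1 α)` of the accepted lang.S03 and of the
sector routes for direction (B) of the summit `Langlands`. [folklore] -/
theorem isAutomorphicAE_iff :
    IsAutomorphicAE ι hcpt ρ ↔
      ∃ π : CuspidalAutomorphicRepData n K hcpt, π.1.IsLAlgebraic ∧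
        ∀ᶠ v : HeightOneSpectrum (𝓞 K) in cofinite, ∃ α : Multiset ℂ,
          π.1.HasSatakeParamAt v α ∧ ρ.IsUnramifiedAt v ∧
            ρ.HasFrobCharpolyAt v (arithFrobPolyOfSatake ι v.residueCard 1 α) :=
  Iff.rfl

variable (ι hcpt ρ) in
/-- Automorphy is invariant under a change of frame `ρ ↦ P ρ P⁻¹` (`FramedRep.conj`).
Serre 1968, Ch. I §2.3. [folklore] -/
theorem isAutomorphicAE_conj_iff (P : GL (Fin n) (PadicAlgCl ℓ)) :
    IsAutomorphicAE ι hcpt (FramedRep.conj P ρ) ↔ IsAutomorphicAE ι hcpt ρ :=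
  exists_congr fun π ↦ and_congr_right fun _ ↦ satakeFrobCompatibleAE_conj_iff ι π.1 ρ P

/-- Automorphy is an invariant of the isomorphism class of the continuous representation on
`ℚ̄_ℓⁿ` underlying `ρ` (`ContinuousRep.Equiv`; equivalent framed representations are conjugate).
Serre 1968, Ch. I §1.1, §2.3. [cite: SerreAbelianLadic1968, Ch. I §2.3] -/
theorem IsAutomorphicAE.of_equiv (e : ContinuousRep.Equiv ρ.toGaloisRep ρ'.toGaloisRep)
    (h : IsAutomorphicAE ι hcpt ρ) : IsAutomorphicAE ι hcpt ρ' := by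
  obtain ⟨π, hL, hπ⟩ := h
  exact ⟨π, hL, hπ.of_equiv e⟩

/-- An automorphic `ρ` is unramified at all but finitely many places. Buzzard–Gee 2014,
Conj. 3.2.1–3.2.2. [folklore] -/
theorem IsAutomorphicAE.eventually_isUnramifiedAt (h : IsAutomorphicAE ι hcpt ρ) :
    ∀ᶠ v : HeightOneSpectrum (𝓞 K) in cofinite, ρ.IsUnramifiedAt v := by
  obtain ⟨π, _, hπ⟩ := h
  exact hπ.eventually_isUnramifiedAt.mono fun _ hv ↦ hv.2

/-- **Bridge to the summit's `Corresponds`.**  The local–global compatibility clause (defined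
problem-side, `Summit.Langlands.LocalGlobalCompatibleAt`, which `Literature/` cannot import) enters
as a parameter `C`: if `ρ` is automorphic and every L-algebraic cuspidal `π` attached to `ρ` at
almost all places satisfies `C π` (the content of local–global compatibility theorems of
Taylor–Yoshida / Caraiani / Varma type, or of the summit's direction (A) combined with strong
multiplicity one), then some L-algebraic cuspidal `π` is attached to `ρ` at almost all places AND
satisfies `C π`.  With `C π := ∀ v, Summit.Langlands.LocalGlobalCompatibleAt 𝓡 ι π.1 ρ v` the
conclusion is definitionally `∃ π, π.1.IsLAlgebraic ∧ Summit.Langlands.Corresponds 𝓡 ι π.1 ρ`.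
Pure logic. [folklore] -/
theorem IsAutomorphicAE.exists_of_imp {C : CuspidalAutomorphicRepData n K hcpt → Prop}
    (h : IsAutomorphicAE ι hcpt ρ)
    (hC : ∀ π : CuspidalAutomorphicRepData n K hcpt, π.1.IsLAlgebraic →
      SatakeFrobCompatibleAE ι π.1 ρ → C π) :
    ∃ π : CuspidalAutomorphicRepData n K hcpt,
      π.1.IsLAlgebraic ∧ SatakeFrobCompatibleAE ι π.1 ρ ∧ C π := by
  obtain ⟨π, hL, hπ⟩ := h
  exact ⟨π, hL, hπ, hC π hL hπ⟩

end Automorphic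

/-! ## lang.S03 in terms of `IsAutomorphicAE` -/

section FontaineMazurLanglands

/-- The accepted Fontaine–Mazur–Langlands conjecture for `GL_n` (`FontaineMazurLanglandsGLn 𝔅 n`,
lang.S03) says exactly that every irreducible geometric `r : Γ_K →ₜ* GL_n(ℚ̄_ℓ)` (geometric relative
to the de Rham data `𝔅`, through a finite model `rE`) is automorphic in the sense of
`IsAutomorphicAE` — definitionally (`Iff.rfl`). Fontaine–Mazur 1995, Conj. 1; Buzzard–Gee 2014,
Conj. 3.2.2. [cite: FontaineMazurGeometric1995, Conj. 1] -/
theorem fontaineMazurLanglandsGLn_iff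
    (𝔅 : ∀ (K : Type) [Field K] [NumberField K] (ℓ : ℕ) [Fact ℓ.Prime], DeRhamData K ℓ) (n : ℕ) :
    FontaineMazurLanglandsGLn 𝔅 n ↔
      ∀ (K : Type) [Field K] [NumberField K] (hcpt : isCompact_glFiniteIntegralLevel n K)
        (ℓ : ℕ) [Fact ℓ.Prime] (ι : PadicAlgCl ℓ ≃+* ℂ)
        (E : IntermediateField ℚ_[ℓ] (PadicAlgCl ℓ)) [FiniteDimensional ℚ_[ℓ] E]
        (rE : FramedGaloisRep K E n) (r : FramedGaloisRep K (PadicAlgCl ℓ) n),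
        HasQlModel r E rE → r.toGaloisRep.IsIrreducible →
          (restrictScalarsQl E rE).IsGeometric (𝔅 K ℓ) → IsAutomorphicAE ι hcpt r :=
  Iff.rfl

end FontaineMazurLanglands

end Literature.NumberTheory.Automorphic

end
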